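import Summits.QuantumFields.YangMills.Theorems.AlphaInputsT3ACv3StepLowTrivPins
import HarnessLib

/-!
# `AlphaInputsT3ACv3StepTrivPinsChart` — BOTH trivial-history fibre rows (`PinnedStep.Fibre55WinAC … triv′`, `PinnedStep.Fibre57LowOnAC lo k`) AT EVERY
# LEVEL `k`, ANY GAUGE GROUP, FOR ANY ABSOLUTELY CONTINUOUS AVERAGING WITH A WEIGHTED FIBRE CHART — the averaging-agnostic form of
# `…AlphaInputsT3ACv3StepTrivPins` ∕ `…StepLowTrivPins` (which are its instance at the lane's axial averaging, `G = SU(2)`), written so that the T³ record's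
# `blockAvg ℰp` plugs in through ONE hypothesis `hchart` (cell ym3-torus; desk pub/ym-inputs INPUT-LIST v7 §3 I-10 ∕ I-12, memo `I10-B2-FIBRE-LOCATE-p08.md`;
# seat ym-inputs-p08 g2; helper `--supports stmt-QuantumFields-20520`)

WHY.  The two files landed before this one prove the rows under `hav : (X.av k).avg = axialAvg` — the lane's decimation averaging — because that is
the averaging whose gauge-fixed fibre is a product Haar integral (`AxialGaugeShift`, `FluctChartSU2`).  The T³ record pins `BlockAveraging.blockAvg ℰp`
(`AlphaInputsT3AC.avT3_of_le`), whose fibre print resolves by a chart WITH A DENSITY ([Balaban1985UV3] (13)–(18) pp.259–260: `U = exp(i(A − D̃(A)))·U₁(V)`,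
Jacobian `det(I − (δ∕δA)D̃(A))`, Haar density `σ∕σ₀`, constraint `δ(QA)δ_{Ax}(A)`; generic socket `…AlphaInputsT3ACWeightedFibreFormula`).  THIS FILE
isolates what the rows need of the averaging into ONE displayed hypothesis and proves both rows from it, for ANY gauge group `G`, ANY AC inputs `X`
(any averaging), ANY parameter space `(Ω, vol)`:
* `hchart` — A WEIGHTED FIBRE CHART OF `Ū = (X.av k).avg` WITH PRINT'S NORMALISATION: a map `Φ : (V, ω) ↦ U` landing in the fibres (`hfibΦ : Ū(Φ(V,ω)) = V`)
  and a weight `J ≥ 0` such that for every measurable, BOUNDED, gauge-invariant density `ρ`,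
  `(T_kρ)(V) = e^{(ℓσ + d_g·log g_k)·N} · ∫ J(V,ω)·ρ(Φ(V,ω)) dvol(ω)` dV-a.e. — for the axial averaging at `SU(2)`: `Ω = 𝔰𝔲(2)^{Free}`, `vol` = Lebesgue,
  `Φ = FluctGaussSU2.fieldAt U₁ g_k`, `J = 𝟙_{ball}·Πσ(g_kA′_b)∕σ₀`, `ℓσ = log σ₀`, `d_g = 3`, `N = #Free` (the sibling
  `…StepTrivPinsChartAxial.hchart_axial`, from `AxialGaugeShift.rnTransport_ae_eq_integral_fluct` + `FluctChartSU2`); for `blockAvg ℰp`: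
  `WeightedFibreFormula.rnTransport_ae_eq_weightedFibreIntegral(_local)` at print's chart — (B2-F2), not in the tree;
* the quadratic datum `q_V` on `Ω` with `Z_q(V) = ∫e^{−q_V} dvol > 0` ((53)–(54)); the data rows `hU`∕`hPm`∕`hPb` at `(k, triv)`; the displayed gauge invariance
  `hinv` of the (41)_k integrand at `triv`; the window facts `hwt`∕`hsmall` (upper row) resp. `hlom`∕`hloinv`∕`hdom`∕`hpos` + integrability of the chart
  weight `hJi` (lower row) — all as in the axial files, with `Ū` for `axialAvg`;
* the (55) PINS of `piecesAC 𝔎 X 𝔖 k` at `triv′`: `logσ₀ = ℓσ`, `dg = d_g`, `starB(triv′) = N` (for the lane's carriers and `N = #Free`: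
  `PinnedStepTrivPins.starB_piecesAC_triv`), `logZU(triv′,V) = log Z_q(V)`, `logFl(triv′,V) = log ∫Ψ dμ_V` with
  **Ψ_{k,V}(ω) = J(V,ω)·χB_k(triv′)(Φ(V,ω))·exp[−(mainT_k(triv,Φ(V,ω)) − mainT_{k+1}(triv′,V)) + (𝒫_k(triv,Φ(V,ω)) − 𝒫old(triv′,V)) + q_V(ω)]** — print's (55)
  fluctuation integrand with (58)'s recentring and, inside `J`, print's `𝓋(A)` factors of (20)–(21).
THEN `fibre55WinAC_triv_of_chart : PinnedStep.Fibre55WinAC 𝔎 X 𝔖 win k (Hist.triv S.P (k+1))` and `fibre57LowOnAC_of_chart : PinnedStep.Fibre57LowOnAC 𝔎 X 𝔖 lo k`.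
No background-section hypothesis (`U₁`, `hbg`) is needed in this form: the recentring by `mainT_{k+1}(triv′,V)` is bookkeeping.

HONEST SCOPE.  [folklore] measure theory + bookkeeping; nothing of [Balaban1985UV3] asserted; the rows are proved MODULO `hchart` (the located brick
(B2-F2) for the record's averaging), the pins and the displayed rows — NO (O″χ) row is discharged at free data (RULING g26-№2); count-neutral; no summit ∕
sub-problem statement proved (rung R3 bookkeeping; not T⁴, not Clay; the Yang–Mills mass gap is NOT proved).  Def-free; L-floor: none.
References: T. Bałaban, CMP 102 (1985) 255–275 [Balaban1985UV3] ((13)–(22) pp.259–261, (37) p.265, (47)–(51) pp.267–268, (53)–(58) pp.269–270, p.272 L32–33);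
CMP 98 (1985) 17–51 [Balaban1985Averaging] ((10) p.19).
-/

set_option autoImplicit false

noncomputable section

namespace Summit.QuantumFields.YangMills.Theorems.PinnedStepTrivPins

open MeasureTheory Literature.MathematicalPhysics.QuantumFieldTheory.Balaban1983to89
open Literature.MathematicalPhysics.QuantumFieldTheory.Balaban1983to89.AveragingRT (rnTransport)
open Literature.MathematicalPhysics.QuantumFieldTheory.Balaban1983to89.GaugeField (GaugeInvariant gaugeAct)
open Literature.MathematicalPhysics.QuantumFieldTheory.Balaban1985CMP102 Literature.MathematicalPhysics.QuantumFieldTheory.Balaban1985CMP102.Setting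
open Summit.QuantumFields.Balaban3D.Carriers
open Summit.QuantumFields.Balaban3D.Proofs.Inputs (LaneConsts)
open Summit.QuantumFields.Balaban3D.Proofs.ScalesArithmetic (gk_pos)
open Summit.QuantumFields.Balaban3D.Proofs.TowerAC Summit.QuantumFields.Balaban3D.Proofs.StandardAC Summit.QuantumFields.Balaban3D.Proofs.InputsAC
open Summit.QuantumFields.Balaban3D.Proofs.Bound55Masses (chiB chiB_nonneg chiB_le_one measurable_chiB)
open Summit.QuantumFields.Balaban3D.Proofs.GaussianNormalization (partZ normalized integral_exp_neg_mul_eq)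
open Summit.QuantumFields.Balaban3D.Proofs (Bound55Std.measurable_actionEta)
open Summit.QuantumFields.YangMills.Theorems.PinnedStep (massP wtP Fibre55WinAC Fibre57LowOnAC)

variable {L : ℕ} (𝔎 : LaneConsts L) {S : Scales L} {G : Type} [GaugeGroup G] [MeasurableSpace G] [HaarData G] [RegularGaugeGroup G]
  {Val : Type} [NormedAddCommGroup Val] [NormedSpace ℂ Val]
  (X : ExternalInputsAC S G) (𝔖 : ∀ k, StepSeries S G Val (nblkOf S 𝔎.carrier k) k)

/-- Real arithmetic of the (55)∕(57) exponents with a general normalisation `c`: `e^{E}·e^{c}·Z·I ≤ e^{E + c + log Z + log I}` for `Z > 0`, `I ≥ 0`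
(equality when `I > 0`). [folklore] -/
theorem exp_mul_le_exp_log_gen (E c Z I : ℝ) (hZ : 0 < Z) (hI : 0 ≤ I) :
    Real.exp E * Real.exp c * Z * I ≤ Real.exp (E + c + Real.log Z + Real.log I) := by
  rw [Real.exp_add, Real.exp_add, Real.exp_add, Real.exp_log hZ]
  refine mul_le_mul_of_nonneg_left ?_ (by positivity)
  rcases hI.eq_or_lt with h0 | hpos
  · rw [← h0]; exact (Real.exp_pos _).le
  · rw [Real.exp_log hpos]

/-- The (41)_k integrand at the trivial history, `χB_k(triv′)·e^{−mainT_k + 𝒫_k + c}`, is measurable, bounded by `e^{c_P + c}` and gauge-invariant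
(given the displayed invariance of `e^{−mainT_k + 𝒫_k}`). [folklore] -/
theorem trivIntegrand_props (k : ℕ) (hU : Measurable (X.UkH k (Hist.triv S.P k)))
    (hPm : Measurable ((inputOfAC 𝔎 X 𝔖).Pint k (Hist.triv S.P k))) (cP : ℝ) (hPb : ∀ U, (inputOfAC 𝔎 X 𝔖).Pint k (Hist.triv S.P k) U ≤ cP)
    (hinv : GaugeInvariant (fun U : GaugeField S.P k G =>
      Real.exp (-((towerOfAC 𝔎 X 𝔖).mainT k (Hist.triv S.P k) U) + (towerOfAC 𝔎 X 𝔖).Pint k (Hist.triv S.P k) U)))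
    (φ : GaugeField S.P k G → ℝ) (hφm : Measurable φ) (hφ0 : ∀ U, 0 ≤ φ U) (hφ1 : ∀ U, φ U ≤ 1) (hφinv : GaugeInvariant φ) (c : ℝ) :
    Measurable (fun U => φ U * Real.exp (-((towerOfAC 𝔎 X 𝔖).mainT k (Hist.triv S.P k) U) + (towerOfAC 𝔎 X 𝔖).Pint k (Hist.triv S.P k) U + c)) ∧
    (∀ U, |φ U * Real.exp (-((towerOfAC 𝔎 X 𝔖).mainT k (Hist.triv S.P k) U) + (towerOfAC 𝔎 X 𝔖).Pint k (Hist.triv S.P k) U + c)|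
        ≤ Real.exp (cP + c)) ∧
    GaugeInvariant (fun U => φ U * Real.exp (-((towerOfAC 𝔎 X 𝔖).mainT k (Hist.triv S.P k) U) + (towerOfAC 𝔎 X 𝔖).Pint k (Hist.triv S.P k) U + c)) := by
  have hmain : ∀ U, (towerOfAC 𝔎 X 𝔖).mainT k (Hist.triv S.P k) U = (S.gk k)⁻¹ ^ 2 * S.actionEta k (X.UkH k (Hist.triv S.P k) U) := fun _ => rfl
  have hPt : ∀ U, (towerOfAC 𝔎 X 𝔖).Pint k (Hist.triv S.P k) U = (inputOfAC 𝔎 X 𝔖).Pint k (Hist.triv S.P k) U := fun _ => rfl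
  refine ⟨?_, fun U => ?_, fun u U => ?_⟩
  · have hexpm : Measurable fun U : GaugeField S.P k G =>
        -((towerOfAC 𝔎 X 𝔖).mainT k (Hist.triv S.P k) U) + (towerOfAC 𝔎 X 𝔖).Pint k (Hist.triv S.P k) U + c := by
      simp_rw [hmain, hPt]
      exact ((measurable_const.mul ((Bound55Std.measurable_actionEta (S := S) k).comp hU)).neg.add hPm).add measurable_const
    exact hφm.mul (Real.measurable_exp.comp hexpm)
  · have h0 := mainT_nonneg 𝔎 X 𝔖 k (Hist.triv S.P k) U; have h1 := hPb U
    rw [abs_mul, Real.abs_exp, abs_of_nonneg (hφ0 U)]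
    refine (mul_le_mul (hφ1 U) (Real.exp_le_exp.mpr ?_) (Real.exp_pos _).le zero_le_one).trans_eq (one_mul _)
    rw [hPt]; linarith
  · have h2 := hinv u U; dsimp only at h2
    dsimp only
    rw [hφinv u U]
    congr 1
    conv_lhs => rw [Real.exp_add]
    conv_rhs => rw [Real.exp_add]
    rw [h2]

section Chart

variable {Ω : Type} [MeasurableSpace Ω]

/-- **THE UPPER ROW `Fibre55WinAC` AT THE TRIVIAL NEW HISTORY, EVERY LEVEL, ANY GAUGE GROUP, ANY AVERAGING WITH A WEIGHTED FIBRE CHART**, modulo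
print's (55) pins — the averaging-agnostic form of `fibre55WinAC_triv_of_pins`. [cite: Balaban1985UV3, (13)–(18) pp.259–260 + (49)–(55) pp.268–269 + (58) p.270] -/
theorem fibre55WinAC_triv_of_chart (win : (k : ℕ) → Hist S.P (k + 1) → Set (GaugeField S.P (k + 1) G)) (k : ℕ) (hk : k + 1 ≤ S.P.m + S.P.K)
    (vol : Measure Ω) (Φ : GaugeField S.P (k + 1) G × Ω → GaugeField S.P k G) (J : GaugeField S.P (k + 1) G × Ω → ℝ) (hJ0 : ∀ z, 0 ≤ J z)
    (hfibΦ : ∀ V ω, (X.av k).avg (Φ (V, ω)) = V) (N lσ dg : ℝ)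
    (hchart : ∀ (ρ : Density S.P k G) (C : ℝ), Measurable ρ → (∀ U, |ρ U| ≤ C) → GaugeInvariant ρ →
      rnTransport (X.av k).avg ρ =ᵐ[fieldMeasure S.P (k + 1) G] fun V =>
        Real.exp ((lσ + dg * Real.log (S.gk k)) * N) * ∫ ω, J (V, ω) * ρ (Φ (V, ω)) ∂vol)
    (q : GaugeField S.P (k + 1) G → Ω → ℝ) (hqm : ∀ V, Measurable (q V)) (hZ : ∀ V, 0 < partZ vol (q V))
    (hU : Measurable (X.UkH k (Hist.triv S.P k))) (hPm : Measurable ((inputOfAC 𝔎 X 𝔖).Pint k (Hist.triv S.P k)))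
    (cP : ℝ) (hPb : ∀ U, (inputOfAC 𝔎 X 𝔖).Pint k (Hist.triv S.P k) U ≤ cP)
    (hinv : GaugeInvariant (fun U : GaugeField S.P k G =>
      Real.exp (-((towerOfAC 𝔎 X 𝔖).mainT k (Hist.triv S.P k) U) + (towerOfAC 𝔎 X 𝔖).Pint k (Hist.triv S.P k) U)))
    (hwt : ∀ U : GaugeField S.P k G,
      chiB 𝔎.carrier.M₁ (rcolOf S 𝔎.carrier) (eps1Of S 𝔎.carrier) k (Hist.triv S.P (k + 1)) U ≠ 0 → wtP 𝔎 X win k (Hist.triv S.P k) U = 1)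
    (hsmall : ∀ U : GaugeField S.P k G,
      chiB 𝔎.carrier.M₁ (rcolOf S 𝔎.carrier) (eps1Of S 𝔎.carrier) k (Hist.triv S.P (k + 1)) U ≠ 0 → (X.av k).avg U ∈ win k (Hist.triv S.P (k + 1)))
    (hσ : (piecesAC 𝔎 X 𝔖 k).logσ₀ = lσ) (hdg : (piecesAC 𝔎 X 𝔖 k).dg = dg) (hstar : (piecesAC 𝔎 X 𝔖 k).starB (Hist.triv S.P (k + 1)) = N)
    (hZU : ∀ V, (piecesAC 𝔎 X 𝔖 k).logZU (Hist.triv S.P (k + 1)) V = Real.log (partZ vol (q V)))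
    (hFl : ∀ V, (piecesAC 𝔎 X 𝔖 k).logFl (Hist.triv S.P (k + 1)) V =
      Real.log (∫ ω, J (V, ω) * chiB 𝔎.carrier.M₁ (rcolOf S 𝔎.carrier) (eps1Of S 𝔎.carrier) k (Hist.triv S.P (k + 1)) (Φ (V, ω)) *
              Real.exp (-((towerOfAC 𝔎 X 𝔖).mainT k (Hist.triv S.P k) (Φ (V, ω)) - (towerOfAC 𝔎 X 𝔖).mainT (k + 1) (Hist.triv S.P (k + 1)) V)
                + ((towerOfAC 𝔎 X 𝔖).Pint k (Hist.triv S.P k) (Φ (V, ω)) - (piecesAC 𝔎 X 𝔖 k).Pold (Hist.triv S.P (k + 1)) V) + q V ω)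
            ∂(normalized vol (q V)))) :
    Fibre55WinAC 𝔎 X 𝔖 win k (Hist.triv S.P (k + 1)) := by
  classical
  set χ₀ : GaugeField S.P k G → ℝ := chiB 𝔎.carrier.M₁ (rcolOf S 𝔎.carrier) (eps1Of S 𝔎.carrier) k (Hist.triv S.P (k + 1)) with hχ₀
  set c : ℝ := -(towerOfAC 𝔎 X 𝔖).Ecst k + (towerOfAC 𝔎 X 𝔖).Zterm k (Hist.triv S.P k) + (towerOfAC 𝔎 X 𝔖).Rm k with hc
  set ρ : Density S.P k G := fun U => χ₀ U *
    Real.exp (-((towerOfAC 𝔎 X 𝔖).mainT k (Hist.triv S.P k) U) + (towerOfAC 𝔎 X 𝔖).Pint k (Hist.triv S.P k) U + c) with hρ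
  have hχm : Measurable χ₀ := measurable_chiB _ _ _ k _
  have hχinv : GaugeInvariant χ₀ := fun u U => chiB_gaugeAct _ _ _ k _ u U
  obtain ⟨hρm, hρb, hρinv⟩ := trivIntegrand_props 𝔎 X 𝔖 k hU hPm cP hPb hinv χ₀ hχm (fun U => chiB_nonneg _ _ _ k _ U)
    (fun U => chiB_le_one _ _ _ k _ U) hχinv c
  -- the row's integrand at `triv′` IS `ρ`
  have hint : (fun U => stepWeight 𝔎.carrier.M₁ (rcolOf S 𝔎.carrier) (eps1Of S 𝔎.carrier) (epsSOf S 𝔎.carrier) k (Hist.triv S.P (k + 1)) U *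
        chiB 𝔎.carrier.M₁ (rcolOf S 𝔎.carrier) (eps1Of S 𝔎.carrier) k (Hist.triv S.P (k + 1)) U *
        (wtP 𝔎 X win k (Hist.triv S.P (k + 1)).proj U *
          Real.exp (-((towerOfAC 𝔎 X 𝔖).mainT k (Hist.triv S.P (k + 1)).proj U) + (towerOfAC 𝔎 X 𝔖).Pint k (Hist.triv S.P (k + 1)).proj U
            - (towerOfAC 𝔎 X 𝔖).Ecst k + (towerOfAC 𝔎 X 𝔖).Zterm k (Hist.triv S.P (k + 1)).proj + (towerOfAC 𝔎 X 𝔖).Rm k))) = ρ := by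
    funext U
    rw [stepWeight_triv 𝔎.carrier.M₁ (rcolOf S 𝔎.carrier) (eps1Of S 𝔎.carrier) (epsSOf S 𝔎.carrier) (by omega) U, one_mul, Hist.proj_triv, hρ]
    dsimp only
    by_cases h0 : chiB 𝔎.carrier.M₁ (rcolOf S 𝔎.carrier) (eps1Of S 𝔎.carrier) k (Hist.triv S.P (k + 1)) U = 0
    · have h0' : χ₀ U = 0 := h0
      rw [h0, h0', zero_mul, zero_mul]
    · rw [hwt U h0, one_mul]; congr 2; rw [hc]; ring
  have hT := hchart ρ _ hρm hρb hρinv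
  have hg : 0 < S.gk k := gk_pos S k
  have hgk : (towerOfAC 𝔎 X 𝔖).g k = S.gk k := rfl
  have hproj : (piecesAC 𝔎 X 𝔖 k).proj (Hist.triv S.P (k + 1)) = Hist.triv S.P k := (piecesAC 𝔎 X 𝔖 k).proj_triv
  unfold Fibre55WinAC
  rw [hint]
  refine hT.trans_le ?_
  filter_upwards with V
  set m₁ : ℝ := (towerOfAC 𝔎 X 𝔖).mainT (k + 1) (Hist.triv S.P (k + 1)) V with hm₁
  set Po : ℝ := (piecesAC 𝔎 X 𝔖 k).Pold (Hist.triv S.P (k + 1)) V with hPo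
  by_cases hV : V ∈ win k (Hist.triv S.P (k + 1))
  · rw [Set.indicator_of_mem hV, one_mul, massP_triv 𝔎 X (k + 1) V, one_mul, hσ, hdg, hgk, hstar, hZU V, hproj, hFl V]
    -- the transported integrand as `Z_q(V)` times the normalised integral of `Ψ·e^{−m₁ + Po + c}`
    have hΨ : ∀ ω, J (V, ω) * ρ (Φ (V, ω)) = Real.exp (-(q V ω)) * (Real.exp (-m₁ + Po + c) *
        (J (V, ω) * χ₀ (Φ (V, ω)) * Real.exp (-((towerOfAC 𝔎 X 𝔖).mainT k (Hist.triv S.P k) (Φ (V, ω)) - m₁)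
          + ((towerOfAC 𝔎 X 𝔖).Pint k (Hist.triv S.P k) (Φ (V, ω)) - Po) + q V ω))) := fun ω => by
      rw [hρ]; dsimp only
      have e : Real.exp (-((towerOfAC 𝔎 X 𝔖).mainT k (Hist.triv S.P k) (Φ (V, ω))) + (towerOfAC 𝔎 X 𝔖).Pint k (Hist.triv S.P k) (Φ (V, ω)) + c)
          = Real.exp (-(q V ω)) * (Real.exp (-m₁ + Po + c) * Real.exp (-((towerOfAC 𝔎 X 𝔖).mainT k (Hist.triv S.P k) (Φ (V, ω)) - m₁)
            + ((towerOfAC 𝔎 X 𝔖).Pint k (Hist.triv S.P k) (Φ (V, ω)) - Po) + q V ω)) := by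
        rw [← Real.exp_add, ← Real.exp_add]; congr 1; ring
      rw [e]; ring
    simp_rw [hΨ]
    rw [integral_exp_neg_mul_eq (hqm V) (hZ V), integral_const_mul]
    have hI0 : 0 ≤ ∫ ω, J (V, ω) * χ₀ (Φ (V, ω)) * Real.exp (-((towerOfAC 𝔎 X 𝔖).mainT k (Hist.triv S.P k) (Φ (V, ω)) - m₁)
          + ((towerOfAC 𝔎 X 𝔖).Pint k (Hist.triv S.P k) (Φ (V, ω)) - Po) + q V ω) ∂(normalized vol (q V)) :=
      integral_nonneg fun ω => mul_nonneg (mul_nonneg (hJ0 _) (chiB_nonneg _ _ _ k _ _)) (Real.exp_pos _).le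
    refine le_trans (le_of_eq ?_) ((exp_mul_le_exp_log_gen (-m₁ - (towerOfAC 𝔎 X 𝔖).Ecst k + Po + (towerOfAC 𝔎 X 𝔖).Zterm k (Hist.triv S.P k)
      + (towerOfAC 𝔎 X 𝔖).Rm k) ((lσ + dg * Real.log (S.gk k)) * N) _ _ (hZ V) hI0).trans_eq ?_)
    · have e : Real.exp (-m₁ + Po + c) = Real.exp (-m₁ - (towerOfAC 𝔎 X 𝔖).Ecst k + Po + (towerOfAC 𝔎 X 𝔖).Zterm k (Hist.triv S.P k)
          + (towerOfAC 𝔎 X 𝔖).Rm k) := by congr 1; rw [hc]; ring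
      rw [e]; ring
    · congr 1; ring
  · rw [Set.indicator_of_notMem hV, zero_mul, zero_mul]
    have hzero : (fun ω => J (V, ω) * ρ (Φ (V, ω))) = fun _ => 0 := by
      funext ω
      have hχ : χ₀ (Φ (V, ω)) = 0 := by
        by_contra h
        exact hV (by simpa only [hfibΦ V ω] using hsmall _ h)
      rw [hρ]; dsimp only; rw [hχ, zero_mul, mul_zero]
    rw [hzero, integral_zero, mul_zero]

/-- **THE LOWER ROW `Fibre57LowOnAC` AT EVERY LEVEL, ANY GAUGE GROUP, ANY AVERAGING WITH A WEIGHTED FIBRE CHART**, modulo the same pins and the two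
k = 0-shaped rows `hdom`∕`hpos` — the averaging-agnostic form of `fibre57LowOnAC_of_pins` (extra: the chart weight is integrable on each fibre, `hJi`,
and `ω ↦ Φ(V,ω)` is measurable). [cite: Balaban1985UV3, (37) p.265 + (47) p.267 + (55)–(58) pp.269–270 + p.272 L32–33] -/
theorem fibre57LowOnAC_of_chart (lo : (k : ℕ) → Set (GaugeField S.P k G)) (k : ℕ)
    (vol : Measure Ω) (Φ : GaugeField S.P (k + 1) G × Ω → GaugeField S.P k G) (J : GaugeField S.P (k + 1) G × Ω → ℝ) (hJ0 : ∀ z, 0 ≤ J z)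
    (hΦm : ∀ V, Measurable fun ω => Φ (V, ω)) (hJi : ∀ V, Integrable (fun ω => J (V, ω)) vol)
    (N lσ dg : ℝ)
    (hchart : ∀ (ρ : Density S.P k G) (C : ℝ), Measurable ρ → (∀ U, |ρ U| ≤ C) → GaugeInvariant ρ →
      rnTransport (X.av k).avg ρ =ᵐ[fieldMeasure S.P (k + 1) G] fun V =>
        Real.exp ((lσ + dg * Real.log (S.gk k)) * N) * ∫ ω, J (V, ω) * ρ (Φ (V, ω)) ∂vol)
    (q : GaugeField S.P (k + 1) G → Ω → ℝ) (hqm : ∀ V, Measurable (q V)) (hZ : ∀ V, 0 < partZ vol (q V))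
    (hU : Measurable (X.UkH k (Hist.triv S.P k))) (hPm : Measurable ((inputOfAC 𝔎 X 𝔖).Pint k (Hist.triv S.P k)))
    (cP : ℝ) (hPb : ∀ U, (inputOfAC 𝔎 X 𝔖).Pint k (Hist.triv S.P k) U ≤ cP)
    (hinv : GaugeInvariant (fun U : GaugeField S.P k G =>
      Real.exp (-((towerOfAC 𝔎 X 𝔖).mainT k (Hist.triv S.P k) U) + (towerOfAC 𝔎 X 𝔖).Pint k (Hist.triv S.P k) U)))
    (hlom : MeasurableSet (lo k)) (hloinv : ∀ (u : GaugeTransf S.P k G) (U : GaugeField S.P k G), gaugeAct u U ∈ lo k ↔ U ∈ lo k)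
    (hdom : ∀ U : GaugeField S.P k G,
      chiB 𝔎.carrier.M₁ (rcolOf S 𝔎.carrier) (eps1Of S 𝔎.carrier) k (Hist.triv S.P (k + 1)) U ≠ 0 → U ∈ lo k)
    (hσ : (piecesAC 𝔎 X 𝔖 k).logσ₀ = lσ) (hdg : (piecesAC 𝔎 X 𝔖 k).dg = dg) (hstar : (piecesAC 𝔎 X 𝔖 k).starB (Hist.triv S.P (k + 1)) = N)
    (hZU : ∀ V, (piecesAC 𝔎 X 𝔖 k).logZU (Hist.triv S.P (k + 1)) V = Real.log (partZ vol (q V)))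
    (hFl : ∀ V, (piecesAC 𝔎 X 𝔖 k).logFl (Hist.triv S.P (k + 1)) V =
      Real.log (∫ ω, J (V, ω) * chiB 𝔎.carrier.M₁ (rcolOf S 𝔎.carrier) (eps1Of S 𝔎.carrier) k (Hist.triv S.P (k + 1)) (Φ (V, ω)) *
              Real.exp (-((towerOfAC 𝔎 X 𝔖).mainT k (Hist.triv S.P k) (Φ (V, ω)) - (towerOfAC 𝔎 X 𝔖).mainT (k + 1) (Hist.triv S.P (k + 1)) V)
                + ((towerOfAC 𝔎 X 𝔖).Pint k (Hist.triv S.P k) (Φ (V, ω)) - (piecesAC 𝔎 X 𝔖 k).Pold (Hist.triv S.P (k + 1)) V) + q V ω)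
            ∂(normalized vol (q V))))
    (hpos : ∀ V, V ∈ lo (k + 1) →
      0 < ∫ ω, J (V, ω) * chiB 𝔎.carrier.M₁ (rcolOf S 𝔎.carrier) (eps1Of S 𝔎.carrier) k (Hist.triv S.P (k + 1)) (Φ (V, ω)) *
              Real.exp (-((towerOfAC 𝔎 X 𝔖).mainT k (Hist.triv S.P k) (Φ (V, ω)) - (towerOfAC 𝔎 X 𝔖).mainT (k + 1) (Hist.triv S.P (k + 1)) V)
                + ((towerOfAC 𝔎 X 𝔖).Pint k (Hist.triv S.P k) (Φ (V, ω)) - (piecesAC 𝔎 X 𝔖 k).Pold (Hist.triv S.P (k + 1)) V) + q V ω)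
            ∂(normalized vol (q V))) :
    Fibre57LowOnAC 𝔎 X 𝔖 lo k := by
  classical
  set χ₀ : GaugeField S.P k G → ℝ := chiB 𝔎.carrier.M₁ (rcolOf S 𝔎.carrier) (eps1Of S 𝔎.carrier) k (Hist.triv S.P (k + 1)) with hχ₀
  set φ : GaugeField S.P k G → ℝ := (lo k).indicator (fun _ => (1 : ℝ)) with hφ
  set c : ℝ := -(towerOfAC 𝔎 X 𝔖).Ecst k - (towerOfAC 𝔎 X 𝔖).Rm k with hc
  have hφm : Measurable φ := measurable_const.indicator hlom
  have hφ0 : ∀ U, 0 ≤ φ U := fun U => Set.indicator_nonneg (fun _ _ => zero_le_one) U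
  have hφ1 : ∀ U, φ U ≤ 1 := fun U => Set.indicator_le_self' (fun _ _ => zero_le_one) U
  have hφinv : GaugeInvariant φ := fun u U => by
    rw [hφ]
    by_cases hU' : U ∈ lo k
    · rw [Set.indicator_of_mem hU', Set.indicator_of_mem ((hloinv u U).2 hU')]
    · rw [Set.indicator_of_notMem hU', Set.indicator_of_notMem (fun h => hU' ((hloinv u U).1 h))]
  have hχm : Measurable χ₀ := measurable_chiB _ _ _ k _
  have hχinv : GaugeInvariant χ₀ := fun u U => chiB_gaugeAct _ _ _ k _ u U
  -- the two integrands: `φ`-cut (the row's) and `χB`-cut (the pins')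
  set ρφ : Density S.P k G := fun U => φ U *
    Real.exp (-((towerOfAC 𝔎 X 𝔖).mainT k (Hist.triv S.P k) U) + (towerOfAC 𝔎 X 𝔖).Pint k (Hist.triv S.P k) U + c) with hρφ
  set ρχ : Density S.P k G := fun U => χ₀ U *
    Real.exp (-((towerOfAC 𝔎 X 𝔖).mainT k (Hist.triv S.P k) U) + (towerOfAC 𝔎 X 𝔖).Pint k (Hist.triv S.P k) U + c) with hρχ
  obtain ⟨hρφm, hρφb, hρφinv⟩ := trivIntegrand_props 𝔎 X 𝔖 k hU hPm cP hPb hinv φ hφm hφ0 hφ1 hφinv c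
  obtain ⟨hρχm, hρχb, -⟩ := trivIntegrand_props 𝔎 X 𝔖 k hU hPm cP hPb hinv χ₀ hχm (fun U => chiB_nonneg _ _ _ k _ U)
    (fun U => chiB_le_one _ _ _ k _ U) hχinv c
  have hint : (fun U : GaugeField S.P k G => φ U *
      Real.exp (-((towerOfAC 𝔎 X 𝔖).mainT k (Hist.triv S.P k) U) + (towerOfAC 𝔎 X 𝔖).Pint k (Hist.triv S.P k) U
        - (towerOfAC 𝔎 X 𝔖).Ecst k - (towerOfAC 𝔎 X 𝔖).Rm k)) = ρφ := by
    funext U; rw [hρφ]; dsimp only; congr 2; rw [hc]; ring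
  have hT := hchart ρφ _ hρφm hρφb hρφinv
  have hg : 0 < S.gk k := gk_pos S k
  have hgk : (towerOfAC 𝔎 X 𝔖).g k = S.gk k := rfl
  unfold Fibre57LowOnAC
  rw [hint]
  refine Filter.EventuallyLE.trans ?_ hT.symm.le
  filter_upwards with V
  set m₁ : ℝ := (towerOfAC 𝔎 X 𝔖).mainT (k + 1) (Hist.triv S.P (k + 1)) V with hm₁
  set Po : ℝ := (piecesAC 𝔎 X 𝔖 k).Pold (Hist.triv S.P (k + 1)) V with hPo
  -- pointwise comparison of the two cuts and integrability on the fibre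
  have hle : ∀ ω, J (V, ω) * ρχ (Φ (V, ω)) ≤ J (V, ω) * ρφ (Φ (V, ω)) := fun ω => by
    refine mul_le_mul_of_nonneg_left ?_ (hJ0 _)
    rw [hρχ, hρφ]; dsimp only
    refine mul_le_mul_of_nonneg_right ?_ (Real.exp_pos _).le
    by_cases h0 : χ₀ (Φ (V, ω)) = 0
    · rw [h0]; exact hφ0 _
    · rw [hφ, Set.indicator_of_mem (hdom _ h0)]; exact chiB_le_one _ _ _ k _ _
  have hintφ : Integrable (fun ω => J (V, ω) * ρφ (Φ (V, ω))) vol :=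
    (hJi V).mul_bdd ((hρφm.comp (hΦm V)).aestronglyMeasurable) (Filter.Eventually.of_forall fun ω => by
      rw [Real.norm_eq_abs]; exact hρφb _)
  have hintχ : Integrable (fun ω => J (V, ω) * ρχ (Φ (V, ω))) vol :=
    (hJi V).mul_bdd ((hρχm.comp (hΦm V)).aestronglyMeasurable) (Filter.Eventually.of_forall fun ω => by
      rw [Real.norm_eq_abs]; exact hρχb _)
  have hmono : Real.exp ((lσ + dg * Real.log (S.gk k)) * N) * ∫ ω, J (V, ω) * ρχ (Φ (V, ω)) ∂vol
      ≤ Real.exp ((lσ + dg * Real.log (S.gk k)) * N) * ∫ ω, J (V, ω) * ρφ (Φ (V, ω)) ∂vol :=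
    mul_le_mul_of_nonneg_left (integral_mono hintχ hintφ hle) (Real.exp_pos _).le
  by_cases hV : V ∈ lo (k + 1)
  · rw [Set.indicator_of_mem hV, one_mul, hσ, hdg, hgk, hstar, hZU V, hFl V]
    refine le_trans (le_of_eq ?_) hmono
    -- the `χB`-cut integral in the pins' currency
    have hΨ : ∀ ω, J (V, ω) * ρχ (Φ (V, ω)) = Real.exp (-(q V ω)) * (Real.exp (-m₁ + Po + c) *
        (J (V, ω) * χ₀ (Φ (V, ω)) * Real.exp (-((towerOfAC 𝔎 X 𝔖).mainT k (Hist.triv S.P k) (Φ (V, ω)) - m₁)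
          + ((towerOfAC 𝔎 X 𝔖).Pint k (Hist.triv S.P k) (Φ (V, ω)) - Po) + q V ω))) := fun ω => by
      rw [hρχ]; dsimp only
      have e : Real.exp (-((towerOfAC 𝔎 X 𝔖).mainT k (Hist.triv S.P k) (Φ (V, ω))) + (towerOfAC 𝔎 X 𝔖).Pint k (Hist.triv S.P k) (Φ (V, ω)) + c)
          = Real.exp (-(q V ω)) * (Real.exp (-m₁ + Po + c) * Real.exp (-((towerOfAC 𝔎 X 𝔖).mainT k (Hist.triv S.P k) (Φ (V, ω)) - m₁)
            + ((towerOfAC 𝔎 X 𝔖).Pint k (Hist.triv S.P k) (Φ (V, ω)) - Po) + q V ω)) := by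
        rw [← Real.exp_add, ← Real.exp_add]; congr 1; ring
      rw [e]; ring
    simp_rw [hΨ]
    rw [integral_exp_neg_mul_eq (hqm V) (hZ V), integral_const_mul]
    conv_rhs => rw [← Real.exp_log (hZ V), ← Real.exp_log (hpos V hV), ← Real.exp_add, ← Real.exp_add, ← Real.exp_add]
    congr 1; rw [hc]; ring
  · rw [Set.indicator_of_notMem hV, zero_mul]
    exact mul_nonneg (Real.exp_pos _).le (integral_nonneg fun ω => mul_nonneg (hJ0 _)
      (by rw [hρφ]; dsimp only; exact mul_nonneg (hφ0 _) (Real.exp_pos _).le))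

end Chart

end Summit.QuantumFields.YangMills.Theorems.PinnedStepTrivPins

end
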